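import Literature.AlgebraicGeometry.Smoothening.ForestStepData
import Literature.AlgebraicGeometry.Smoothening.ForestCentre
import HarnessLib

/-!
# Density of the specialisations in the centre of a smoothening step (BLR 3.4, hypothesis `hinj`)

Topic: `Literature/AlgebraicGeometry/Smoothening` (Bosch–Lütkebohmert–Raynaud, *Néron Models*,
§3.3 Lemma 4 / Prop. 5 and §3.4: the specialisations of the points of `E^i` are dense in the
centre `Y^i_k`, so that the special fibre of the dilatation dominates the centre). In chart
coordinates: for the canonical centre `𝔶̃ = maxCentre` (`ForestCentre`) and a chart `D(H)` on
which `𝔶̃` and `(ϖ, g)` agree (`H 𝔶̃ ⊆ (ϖ, g)`, `H (ϖ, g) ⊆ 𝔶̃`), the map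
`A₁/𝔠 → A₁[𝔠/ϖ]/(ϖ)` from the centre of the chart `A₁ = R[T, U]/I'` to the special fibre of its
dilatation is injective (`quotientMap_injective_of_maxCentre`) — the hypothesis `hinj` of
`DefectDropPointwise`/`ForestStep`. Proof: an element of the kernel vanishes, modulo `𝔪`, at the
lift of every test point of the chart (the lift exists by the universal property of the
dilatation), hence is zero by the density of the test points in `Y ∩ D(H)`
(`SpecializationIdeal.eq_zero_of_forall_residue_eq_zero_away`, the centre of the chart being the
localisation of `R[T]/𝔶̃` away from `H̄`, `ChartCentre.isLocalization_away_centre`).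
[folklore]; no named facts (D-0026).

## References

* S. Bosch, W. Lütkebohmert, M. Raynaud, *Néron Models*, Springer 1990, §3.3 Lemma 4, §3.4.
  [BLRNeronModels1990] (Not held; numbers only.)
-/

noncomputable section

open MvPolynomial IsLocalRing
open Literature.AlgebraicGeometry.Dilatations Literature.AlgebraicGeometry.Resolution

namespace Literature.AlgebraicGeometry.Smoothening

universe u

variable {R : Type u} [CommRing R] (ϖ : R) {N r : ℕ} (I 𝔷 : Ideal (MvPolynomial (Fin N) R))
  (M : ℕ) (g : Fin r → MvPolynomial (Fin N) R) (H : MvPolynomial (Fin N) R)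

local notation "A₁" => MvPolynomial (Fin (N + 1)) R ⧸ chartIdeal I H
local notation "D₁" => dilatation ϖ (centreIdeal ϖ (chartIdeal I H) (chartGens g H))

/-- The centre ideal of the chart is the image of `𝔠 = (ϖ, g, hU - 1)`. [folklore] -/
theorem centreIdeal_chart_eq_map :
    centreIdeal ϖ (chartIdeal I H) (chartGens g H) =
      (centreIdealB ϖ (chartGens g H)).map (Ideal.Quotient.mk (chartIdeal I H)) := by
  rw [centreIdeal, centreIdealB, Ideal.map_span, Set.image_insert_eq, ← Set.range_comp,
    Ideal.Quotient.mk_algebraMap]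
  rfl

/-- A test point of the chart reduces into `V(ḡ)` (`H gⱼ ∈ 𝔶̃` and `H` is a unit at the point).
[folklore] -/
theorem maxPoint_apply_mem (hg : ∀ x ∈ centreIdealB ϖ g, H * x ∈ maxCentre R ϖ I 𝔷 M)
    (e : MaxPoint R ϖ I 𝔷 M) (he : IsUnit (e.a (Ideal.Quotient.mk I H))) (j : Fin r) :
    e.a (Ideal.Quotient.mk I (g j)) ∈ maximalIdeal e.S := by
  have h1 := apply_mem_maximalIdeal_of_maxPoint e
    (hg _ (Ideal.subset_span (Set.mem_insert_of_mem _ ⟨j, rfl⟩)))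
  rw [map_mul, map_mul] at h1
  exact ((IsLocalRing.maximalIdeal.isMaximal _).isPrime.mem_or_mem h1).resolve_left
    fun hH => (IsLocalRing.mem_maximalIdeal _ |>.mp hH) he

/-- **Density ⟹ `hinj`**: for the canonical centre `𝔶̃` and a chart `D(H)` on which `𝔶̃` and
`(ϖ, g)` agree, the map from the centre of the chart `A₁/𝔠` to the special fibre `A₁[𝔠/ϖ]/(ϖ)`
of its dilatation is injective (BLR 3.3/4–5: the specialisations of `E^i` are dense in `Y^i_k`).
[folklore] -/
theorem quotientMap_injective_of_maxCentre
    (h𝔶 : ∀ y ∈ maxCentre R ϖ I 𝔷 M, H * y ∈ centreIdealB ϖ g)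
    (hg : ∀ x ∈ centreIdealB ϖ g, H * x ∈ maxCentre R ϖ I 𝔷 M) :
    Function.Injective (Ideal.quotientMap (Ideal.span {algebraMap R D₁ ϖ}) (algebraMap A₁ D₁)
      (Ideal.map_le_iff_le_comap.mp
        (map_centreIdeal_dilatation_le ϖ (chartIdeal I H) (chartGens g H)))) := by
  classical
  rw [injective_iff_map_eq_zero]
  intro x hx
  obtain ⟨x, rfl⟩ := Ideal.Quotient.mk_surjective x
  obtain ⟨b, rfl⟩ := Ideal.Quotient.mk_surjective x
  -- it suffices that `b ∈ 𝔠`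
  suffices hb : Ideal.Quotient.mk (centreIdealB ϖ (chartGens g H)) b = 0 by
    rw [Ideal.Quotient.eq_zero_iff_mem] at hb ⊢
    rw [centreIdeal_chart_eq_map]
    exact Ideal.mem_map_of_mem _ hb
  -- `hx`: the image of `b` in the dilatation is a multiple of `ϖ`
  rw [Ideal.quotientMap_mk, Ideal.Quotient.eq_zero_iff_mem, Ideal.mem_span_singleton] at hx
  obtain ⟨d, hd⟩ := hx
  -- density in the chart `Y ∩ D(H)`
  letI := algebraCentre ϖ g H (maxCentre R ϖ I 𝔷 M) h𝔶
  haveI := isLocalization_away_centre ϖ g H (maxCentre R ϖ I 𝔷 M) h𝔶 hg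
  refine eq_zero_of_forall_residue_eq_zero_away (fun e : MaxPoint R ϖ I 𝔷 M => e.S)
    (fun e => e.hom) H (MvPolynomial (Fin (N + 1)) R ⧸ centreIdealB ϖ (chartGens g H)) _ ?_
  intro e he y n hyn
  change IsUnit (e.a (Ideal.Quotient.mk I H)) at he
  obtain ⟨z, rfl⟩ := Ideal.Quotient.mk_surjective y
  have hcen_e := maxPoint_apply_mem ϖ I 𝔷 M g H hg e he
  -- the residue map of the centre at `e`
  rw [map_pow, algebraMap_centre_mk, algebraMap_centre_mk] at hyn
  let θ := centreResidue ϖ I g H e.a he e.hπ.not_isUnit hcen_e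
  have key := congrArg θ hyn
  rw [map_mul, map_pow] at key
  simp only [θ, centreResidue_mk, chartPoint_mk_rename] at key
  -- `θ (b) = 0`: the lift of `e` to the dilatation sends `b` to a multiple of `π`
  have hb0 : residue e.S (chartPoint I H e.a he (Ideal.Quotient.mk _ b)) = 0 := by
    rw [residue_eq_zero_iff]
    have h2 := congrArg (dilatationPoint ϖ I g H (chartPoint I H e.a he) e.hπ
      (chartPoint_chartGens_mem I g H e.a he hcen_e)) hd
    rw [dilatationPoint_algebraMap, map_mul, IsScalarTower.algebraMap_apply R A₁ D₁,
      dilatationPoint_algebraMap, AlgHom.commutes] at h2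
    rw [h2]
    exact Ideal.mul_mem_right _ _
      ((IsLocalRing.mem_maximalIdeal _).mpr (mem_nonunits_iff.mpr e.hπ.not_isUnit))
  rw [hb0, zero_mul] at key
  rw [residuePoint_mk]
  exact key.symm

end Literature.AlgebraicGeometry.Smoothening

end
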